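import Mathlib
import Literature.Analysis.Distribution.SchwartzParameterIntegral
import Literature.MathematicalPhysics.QuantumLattice.SchwartzTranslationCutoff

/-!
# Planar test functions as sums of translates of a radial kernel — stub `stub_radialRiemann`

Line `Sketch` of crux `MirrorModularBoosts.SoftKernelBoostCovariance` (stmt-QuantumFields-14999),
stub (T4b) of the registered skeleton `Cruxes/SoftKernelBoostCovariance/Lines/Sketch.lean`.
Pure real analysis on `ℝ × ℝ` (sup norm), nothing about quantum fields.

**Statement** (`stub_radialRiemann`).  Let `a ∈ 𝓢(ℝ × ℝ, ℂ)` have compact support, let `s` be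
a finite set of Schwartz-seminorm indices and `η > 0`.  There is `ρ₀ > 0` (depending on `a, s, η`
only) such that for every radius `0 < ρ ≤ ρ₀` and every *radial profile handed in by the caller*
— a function `φ : ℝ → ℂ` vanishing on `(ρ², ∞)` and a Schwartz map `G` with
`G p = φ (p.1² + p.2²)`, real and nonnegative, `∫ G = 1` — there are finitely many centres
`yᵢ ∈ tsupport a`, coefficients `κᵢ` with `∑ ‖κᵢ‖ ≤ ∫ ‖a‖ + 1` and the translates
`gᵢ = G (· - yᵢ)` (`gᵢ p = φ ((p.1 - yᵢ.1)² + (p.2 - yᵢ.2)²)`) such that every seminorm in `s`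
of `a - ∑ κᵢ • gᵢ` is `< η`.

**Proof.**  Everything happens in the Fréchet space `𝓢 = 𝓢(ℝ × ℝ, ℂ)` through the weak
(Riemann) integral of continuous curves of
`Literature.Analysis.Distribution.SchwartzParameterIntegral` (existence
`SchwartzMap.exists_forall_apply_eq_intervalIntegral`, seminorm bound
`SchwartzMap.seminorm_le_intervalIntegral_of_forall_apply_eq_integral`, convergence of the dyadic
Riemann sums `SchwartzMap.tendsto_riemannSum_of_forall_apply_eq_integral`), iterated once to
integrate continuous families `Φ : ℝ × ℝ → 𝓢` over a square (`exists_schwartz_integral_sq`: the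
inner integrals form a continuous curve by the seminorm bound and the continuity of parametric
interval integrals; Fubini, `integral_eq_intervalIntegral_sq`, identifies the values with
integrals over `ℝ × ℝ`).  No derivative is ever computed.
1. *`ρ₀`.*  Translation `t ↦ a(· - t)` is continuous `ℝ × ℝ → 𝓢`
   (`Literature.MathematicalPhysics.QuantumLattice.continuous_compSubConstCLM`), so there is
   `δ > 0` with `p(a(· - t) - a) < η/2` for `‖t‖ < δ` and all `p ∈ s`; put `ρ₀ = δ/2`.
2. *The kernel.*  `G t ≠ 0 ⇒ t.1² + t.2² ≤ ρ² ⇒ ‖t‖ ≤ ρ`; `‖G‖ = re G`, so `∫ ‖G‖ = 1`.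
3. *Two superpositions.*  `Ψ := ∫ a(y) G(· - y) dy ∈ 𝓢` (family `y ↦ a y • G(· - y)` over a
   square containing `tsupport a`) and `Ψ₃ := ∫ G(t) (a(· - t) - a) dt ∈ 𝓢` (family over the
   square of radius `ρ`); by the change of variables `y = x - t` (`integral_sub_left_eq_self`
   on the group `ℝ × ℝ`) and `∫ G = 1`, `Ψ₃ = Ψ - a` pointwise, hence in `𝓢`.
4. *Mollification, uniformly in the kernel.*  `p(a - Ψ) = p(Ψ₃) ≤ ∫ ‖G t‖ p(a(· - t) - a) dt
   ≤ (η/2) ∫ ‖G‖ = η/2` for `p ∈ s`, since `G t ≠ 0` forces `‖t‖ ≤ ρ < δ`.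
5. *Riemann sums.*  The dyadic Riemann sums in `t₁` of the (continuous) curve of inner integrals
   tend to `Ψ` in `𝓢`, and for a fixed outer mesh the inner dyadic sums tend to the inner
   integrals; the corresponding coefficient masses `∑ Δ₁ Δ₂ ‖a(yᵢⱼ)‖` tend to `∫ ‖a‖`
   (`Literature.Analysis.Distribution.tendsto_riemannSum_intervalIntegral`).  Choose the outer,
   then the inner mesh so that the seminorms in `s` of the two differences are `< η/4` and the
   mass is `< ∫ ‖a‖ + 1`.
6. *The family.*  Keep the grid points `yᵢⱼ` with `a(yᵢⱼ) ≠ 0` (they lie in `tsupport a`; the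
   discarded terms vanish), enumerate them by `Fin I`, and put `κ = Δ₁ Δ₂ a(yᵢⱼ)`,
   `g = G(· - yᵢⱼ)`; then `p(a - ∑ κ • g) < η/2 + η/4 + η/4`.

References: L. Hörmander, *The Analysis of Linear Partial Differential Operators I*, Thm. 1.3.2
and Lemma 7.1.8 (regularisation `u ⋆ φ_ε → u`), §4.1 (superpositions of translates);
W. Rudin, *Functional Analysis*, Thm. 3.27 (weak integrals in Fréchet spaces).  Folklore.
-/

noncomputable section

namespace Summit.QuantumFields.YangMills.Theorems.SoftKernelBoostCovariance.Sketch

open MeasureTheory Set Filter Finset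
open scoped Topology SchwartzMap

/-! ## Iterated parameter integrals in the Schwartz space over a square -/

/-- A continuous function on `ℝ × ℝ` vanishing outside the (sup-norm) ball of radius `M` has
integral equal to the iterated interval integral over the square `[-M, M]²` (Fubini). -/
theorem integral_eq_intervalIntegral_sq {W : Type*} [NormedAddCommGroup W] [NormedSpace ℝ W]
    {h : ℝ × ℝ → W} (hc : Continuous h) {M : ℝ} (hM : 0 ≤ M) (h0 : ∀ t, M < ‖t‖ → h t = 0) :
    ∫ t, h t = ∫ t₁ in -M..M, ∫ t₂ in -M..M, h (t₁, t₂) := by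
  have hK : HasCompactSupport h := HasCompactSupport.intro (isCompact_closedBall (0 : ℝ × ℝ) M)
    fun t ht => h0 t (by simpa [dist_zero_right] using ht)
  have hint : Integrable h ((volume : Measure ℝ).prod volume) :=
    hc.integrable_of_hasCompactSupport hK
  rw [Measure.volume_eq_prod, integral_prod h hint]
  have hout : ∀ t₁ : ℝ, M < |t₁| → ∀ t₂ : ℝ, h (t₁, t₂) = 0 := fun t₁ ht₁ t₂ =>
    h0 _ (lt_max_of_lt_left (by simpa [Real.norm_eq_abs] using ht₁))
  have hin : ∀ t₁ t₂ : ℝ, M < |t₂| → h (t₁, t₂) = 0 := fun t₁ t₂ ht₂ =>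
    h0 _ (lt_max_of_lt_right (by simpa [Real.norm_eq_abs] using ht₂))
  have hnot : ∀ r : ℝ, r ∉ Icc (-M) M → M < |r| := fun r hr =>
    not_le.1 fun h' => hr (mem_Icc.2 (abs_le.1 h'))
  have inner : (fun t₁ => ∫ t₂, h (t₁, t₂)) = fun t₁ => ∫ t₂ in -M..M, h (t₁, t₂) := by
    funext t₁
    rw [intervalIntegral.integral_of_le (by linarith), ← integral_Icc_eq_integral_Ioc,
      setIntegral_eq_integral_of_forall_compl_eq_zero fun t₂ ht₂ => hin t₁ t₂ (hnot t₂ ht₂)]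
  rw [inner, intervalIntegral.integral_of_le (by linarith), ← integral_Icc_eq_integral_Ioc,
    setIntegral_eq_integral_of_forall_compl_eq_zero fun t₁ ht₁ => ?_]
  simp [hout t₁ (hnot t₁ ht₁)]

variable {E : Type*} [NormedAddCommGroup E] [NormedSpace ℝ E]

/-- **Iterated parameter integral of a continuous family in `𝓢(E, ℂ)` over a square.**  For
`Φ : ℝ × ℝ → 𝓢(E, ℂ)` continuous and vanishing outside the sup-norm ball of radius `M`, there
are a continuous curve `Φ₁` of inner integrals, `Φ₁ t₁ (x) = ∫_{-M}^{M} Φ (t₁, t₂) (x) dt₂`,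
and a Schwartz function `Ψ` with `Ψ x = ∫_{-M}^{M} Φ₁ t₁ (x) dt₁ = ∫ Φ t (x) dt`, whose every
Schwartz seminorm is at most `∫ p (Φ t) dt` (the one-variable weak integral of
`Literature.Analysis.Distribution.SchwartzParameterIntegral`, twice). -/
theorem exists_schwartz_integral_sq {Φ : ℝ × ℝ → 𝓢(E, ℂ)} (hΦ : Continuous Φ) {M : ℝ}
    (hM : 0 ≤ M) (h0 : ∀ t, M < ‖t‖ → Φ t = 0) :
    ∃ (Ψ : 𝓢(E, ℂ)) (Φ₁ : ℝ → 𝓢(E, ℂ)), Continuous Φ₁ ∧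
      (∀ t₁ x, Φ₁ t₁ x = ∫ t₂ in -M..M, Φ (t₁, t₂) x) ∧
      (∀ x, Ψ x = ∫ t₁ in -M..M, Φ₁ t₁ x) ∧ (∀ x, Ψ x = ∫ t, Φ t x) ∧
      ∀ k l, SchwartzMap.seminorm ℝ k l Ψ ≤ ∫ t, SchwartzMap.seminorm ℝ k l (Φ t) := by
  have hMM : -M ≤ M := by linarith
  have hcur : ∀ t₁, Continuous fun t₂ => Φ (t₁, t₂) := fun t₁ => hΦ.comp (by fun_prop)
  choose Φ₁ hΦ₁ using fun t₁ =>
    SchwartzMap.exists_forall_apply_eq_intervalIntegral (hcur t₁) hMM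
  -- seminorm-by-seminorm bound for differences of inner integrals
  have hdiff : ∀ (k l : ℕ) (t t₀ : ℝ), SchwartzMap.seminorm ℝ k l (Φ₁ t - Φ₁ t₀) ≤
      ∫ s in -M..M, SchwartzMap.seminorm ℝ k l (Φ (t, s) - Φ (t₀, s)) := fun k l t t₀ => by
    refine SchwartzMap.seminorm_le_intervalIntegral_of_forall_apply_eq_integral
      (Φ := fun s => Φ (t, s) - Φ (t₀, s)) ((hcur t).sub (hcur t₀)) hMM (fun x => ?_) k l
    simp only [sub_apply, hΦ₁]
    rw [← intervalIntegral.integral_sub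
      ((SchwartzMap.continuous_apply_of_continuous (hcur t) x).intervalIntegrable _ _)
      ((SchwartzMap.continuous_apply_of_continuous (hcur t₀) x).intervalIntegrable _ _)]
  have hΦ₁c : Continuous Φ₁ := by
    refine continuous_iff_continuousAt.2 fun t₀ => ?_
    rw [ContinuousAt, (schwartz_withSeminorms ℝ E ℂ).tendsto_nhds]
    rintro ⟨k, l⟩ ε hε
    have hc : Continuous fun t : ℝ =>
        ∫ s in -M..M, SchwartzMap.seminorm ℝ k l (Φ (t, s) - Φ (t₀, s)) :=
      intervalIntegral.continuous_parametric_intervalIntegral_of_continuous'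
        (f := fun t s => SchwartzMap.seminorm ℝ k l (Φ (t, s) - Φ (t₀, s)))
        (((schwartz_withSeminorms ℝ E ℂ).continuous_seminorm (k, l)).comp
          (hΦ.sub (hΦ.comp (by fun_prop)))) _ _
    have h0' := hc.tendsto t₀
    simp only [sub_self, map_zero, intervalIntegral.integral_zero] at h0'
    filter_upwards [h0'.eventually_lt_const hε] with t ht
    rw [SchwartzMap.schwartzSeminormFamily_apply]
    exact (hdiff k l t t₀).trans_lt ht
  obtain ⟨Ψ, hΨ⟩ := SchwartzMap.exists_forall_apply_eq_intervalIntegral hΦ₁c hMM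
  have h0x : ∀ (x : E) (t : ℝ × ℝ), M < ‖t‖ → Φ t x = 0 := fun x t ht => by simp [h0 t ht]
  -- point evaluation along the continuous family `Φ` is continuous
  have hev : ∀ x : E, Continuous fun t => Φ t x := fun x =>
    ((BoundedContinuousFunction.evalCLM ℝ x).comp
      (SchwartzMap.toBoundedContinuousFunctionCLM ℝ E ℂ)).continuous.comp hΦ
  refine ⟨Ψ, Φ₁, hΦ₁c, hΦ₁, hΨ, fun x => ?_, fun k l => ?_⟩
  · rw [hΨ, integral_eq_intervalIntegral_sq (hev x) hM (h0x x)]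
    simp_rw [hΦ₁]
  · calc SchwartzMap.seminorm ℝ k l Ψ ≤ ∫ t₁ in -M..M, SchwartzMap.seminorm ℝ k l (Φ₁ t₁) :=
          SchwartzMap.seminorm_le_intervalIntegral_of_forall_apply_eq_integral hΦ₁c hMM hΨ k l
      _ ≤ ∫ t₁ in -M..M, ∫ t₂ in -M..M, SchwartzMap.seminorm ℝ k l (Φ (t₁, t₂)) := by
          refine intervalIntegral.integral_mono_on hMM ?_ ?_ fun t₁ _ =>
            SchwartzMap.seminorm_le_intervalIntegral_of_forall_apply_eq_integral (hcur t₁) hMM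
              (hΦ₁ t₁) k l
          · exact (((schwartz_withSeminorms ℝ E ℂ).continuous_seminorm (k, l)).comp
              hΦ₁c).intervalIntegrable _ _
          · exact (intervalIntegral.continuous_parametric_intervalIntegral_of_continuous'
              (f := fun t₁ t₂ => SchwartzMap.seminorm ℝ k l (Φ (t₁, t₂)))
              (((schwartz_withSeminorms ℝ E ℂ).continuous_seminorm (k, l)).comp hΦ) _ _
              ).intervalIntegrable _ _
      _ = ∫ t, SchwartzMap.seminorm ℝ k l (Φ t) :=
          (integral_eq_intervalIntegral_sq
            (((schwartz_withSeminorms ℝ E ℂ).continuous_seminorm (k, l)).comp hΦ) hM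
            (fun t ht => by simp [h0 t ht])).symm

/-! ## The stub -/

/-- **Compactly supported planar test functions are limits of finite sums of translates of one
radial bump, with bounded coefficient mass** (stub `stub_radialRiemann`, T4b).  See the module
docstring for the statement and the proof (mollification by the given nonnegative normalised kernel,
uniformly in the kernel, then Riemann sums in `𝓢`). -/
theorem stub_radialRiemann :
    ∀ (a : SchwartzMap (ℝ × ℝ) ℂ), HasCompactSupport (a : ℝ × ℝ → ℂ) →
      ∀ (s : Finset (ℕ × ℕ)) (η : ℝ), 0 < η →
        ∃ ρ₀ : ℝ, 0 < ρ₀ ∧ ∀ ρ : ℝ, 0 < ρ → ρ ≤ ρ₀ →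
          ∀ (φ : ℝ → ℂ) (G : SchwartzMap (ℝ × ℝ) ℂ),
            (∀ r : ℝ, ρ ^ 2 < r → φ r = 0) →
            (∀ p : ℝ × ℝ, G p = φ (p.1 ^ 2 + p.2 ^ 2)) →
            (∀ p : ℝ × ℝ, 0 ≤ (G p).re ∧ (G p).im = 0) →
            (∫ p : ℝ × ℝ, G p) = 1 →
            ∃ (I : ℕ) (y : Fin I → ℝ × ℝ) (κ : Fin I → ℂ) (g : Fin I → SchwartzMap (ℝ × ℝ) ℂ),
              (∀ (i : Fin I) (p : ℝ × ℝ), g i p = φ ((p.1 - (y i).1) ^ 2 + (p.2 - (y i).2) ^ 2)) ∧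
              (∀ i : Fin I, y i ∈ tsupport (a : ℝ × ℝ → ℂ)) ∧
              (∑ i, ‖κ i‖ ≤ (∫ p : ℝ × ℝ, ‖a p‖) + 1) ∧
              (∀ kl ∈ s, SchwartzMap.seminorm ℝ kl.1 kl.2 (a - ∑ i, κ i • g i) < η) := by
  classical
  intro a ha s η hη
  /- Step 1: `ρ₀` from the continuity of translations of `a` in `𝓢`. -/
  set T : ℝ × ℝ → 𝓢(ℝ × ℝ, ℂ) := fun t => SchwartzMap.compSubConstCLM ℝ t a with hT
  have hTc : Continuous T :=
    Literature.MathematicalPhysics.QuantumLattice.continuous_compSubConstCLM ℝ a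
  have hT0 : T 0 = a := by ext x; simp [hT]
  have hev : ∀ᶠ t in 𝓝 (0 : ℝ × ℝ), ∀ kl ∈ s,
      SchwartzMap.seminorm ℝ kl.1 kl.2 (T t - a) < η / 2 := by
    refine s.eventually_all.2 fun kl _ => ?_
    have h := ((schwartz_withSeminorms ℝ (ℝ × ℝ) ℂ).tendsto_nhds T (T 0)).1 (hTc.tendsto 0) kl
      (η / 2) (by positivity)
    rw [hT0] at h
    exact h
  obtain ⟨δ, hδ, hδT⟩ := Metric.eventually_nhds_iff.1 hev
  refine ⟨δ / 2, by positivity, fun ρ hρ hρδ φ G hφ hG hGre hG1 => ?_⟩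
  /- Step 2: the kernel `G` vanishes off the ball of radius `ρ`, `‖G‖ = re G`, `∫ ‖G‖ = 1`. -/
  have hGz : ∀ t : ℝ × ℝ, ρ < ‖t‖ → G t = 0 := fun t ht => by
    rw [hG]
    apply hφ
    rw [Prod.norm_def] at ht
    rcases lt_max_iff.1 ht with h1 | h1 <;> rw [Real.norm_eq_abs] at h1 <;>
      have h2 := mul_self_lt_mul_self hρ.le h1 <;> rw [abs_mul_abs_self] at h2
    · nlinarith [sq_nonneg t.2]
    · nlinarith [sq_nonneg t.1]
  have hGK : HasCompactSupport (G : ℝ × ℝ → ℂ) :=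
    HasCompactSupport.intro (isCompact_closedBall (0 : ℝ × ℝ) ρ) fun t ht =>
      hGz t (by simpa [dist_zero_right] using ht)
  have hGn : ∀ t, ‖G t‖ = (G t).re := fun t => by
    obtain ⟨h1, h2⟩ := hGre t
    have h3 : G t = ((G t).re : ℂ) := Complex.ext (by simp) (by simp [h2])
    rw [h3, Complex.norm_of_nonneg h1, Complex.ofReal_re]
  have hGi : Integrable (G : ℝ × ℝ → ℂ) := G.integrable
  have hG1' : ∫ t, ‖G t‖ = 1 := by
    simp_rw [hGn]
    have h := integral_re hGi
    simp only [RCLike.re_to_complex] at h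
    rw [h, hG1, Complex.one_re]
  /- Step 3: the support radius `M` of `a` and the two superpositions. -/
  obtain ⟨Ma, hMa⟩ := ha.isCompact.isBounded.subset_closedBall (0 : ℝ × ℝ)
  set M : ℝ := |Ma| with hM
  have hM0 : 0 ≤ M := abs_nonneg _
  have hMM : -M ≤ M := by linarith
  have ha0 : ∀ t : ℝ × ℝ, M < ‖t‖ → a t = 0 := fun t ht =>
    image_eq_zero_of_notMem_tsupport fun h => by
      have h' := hMa h
      rw [Metric.mem_closedBall, dist_zero_right] at h'
      linarith [le_abs_self Ma]
  -- translates of `G` weighted by `a`: `Ψ = ∫ a(y) G(· - y) dy`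
  set S : ℝ × ℝ → 𝓢(ℝ × ℝ, ℂ) := fun y => SchwartzMap.compSubConstCLM ℝ y G with hS
  set Φ₂ : ℝ × ℝ → 𝓢(ℝ × ℝ, ℂ) := fun y => a y • S y with hΦ₂
  have hΦ₂c : Continuous Φ₂ :=
    a.continuous.smul (Literature.MathematicalPhysics.QuantumLattice.continuous_compSubConstCLM ℝ G)
  have hΦ₂0 : ∀ t, M < ‖t‖ → Φ₂ t = 0 := fun t ht => by simp [hΦ₂, ha0 t ht]
  obtain ⟨Ψ, Φ₁, hΦ₁c, hΦ₁, hΨ₁, hΨ, -⟩ := exists_schwartz_integral_sq hΦ₂c hM0 hΦ₂0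
  -- translates of `a` weighted by `G`, minus `a`: `Ψ₃ = ∫ G(t) (a(· - t) - a) dt = Ψ - a`
  set Φ₃ : ℝ × ℝ → 𝓢(ℝ × ℝ, ℂ) := fun t => G t • (T t - a) with hΦ₃
  have hΦ₃c : Continuous Φ₃ := G.continuous.smul (hTc.sub continuous_const)
  have hΦ₃0 : ∀ t, ρ < ‖t‖ → Φ₃ t = 0 := fun t ht => by simp [hΦ₃, hGz t ht]
  obtain ⟨Ψ₃, -, -, -, -, hΨ₃, hΨ₃p⟩ := exists_schwartz_integral_sq hΦ₃c hρ.le hΦ₃0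
  have hΨ₃eq : Ψ₃ = Ψ - a := by
    ext x
    rw [hΨ₃, sub_apply, hΨ]
    simp only [hΦ₃, hΦ₂, hT, hS, smul_apply, sub_apply, SchwartzMap.compSubConstCLM_apply,
      smul_eq_mul]
    have h1 : ∫ t, G t * a (x - t) = ∫ y, a y * G (x - y) := by
      rw [← integral_sub_left_eq_self (fun y => a y * G (x - y)) volume x]
      congr 1
      ext t
      rw [sub_sub_cancel, mul_comm]
    have hi1 : Integrable fun t => G t * a (x - t) :=
      (G.continuous.mul (a.continuous.comp (continuous_const.sub continuous_id)))
        |>.integrable_of_hasCompactSupport hGK.mul_right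
    simp_rw [mul_sub]
    rw [integral_sub hi1 (hGi.mul_const _), h1, integral_mul_const, hG1, one_mul]
  /- Step 4: the mollification bound, uniform in the kernel. -/
  have hmoll : ∀ kl ∈ s, SchwartzMap.seminorm ℝ kl.1 kl.2 (a - Ψ) ≤ η / 2 := fun kl hkl => by
    have hsm : ∀ (c : ℂ) (f : 𝓢(ℝ × ℝ, ℂ)), SchwartzMap.seminorm ℝ kl.1 kl.2 (c • f) =
        ‖c‖ * SchwartzMap.seminorm ℝ kl.1 kl.2 f := fun c f =>
      map_smul_eq_mul (SchwartzMap.seminorm ℂ kl.1 kl.2) c f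
    have hneg : a - Ψ = -Ψ₃ := by rw [hΨ₃eq, neg_sub]
    rw [hneg, map_neg_eq_map]
    refine (hΨ₃p kl.1 kl.2).trans ?_
    calc ∫ t, SchwartzMap.seminorm ℝ kl.1 kl.2 (Φ₃ t) ≤ ∫ t, ‖G t‖ * (η / 2) := by
          refine integral_mono_of_nonneg (Eventually.of_forall fun t => apply_nonneg _ _)
            (hGi.norm.mul_const _) (Eventually.of_forall fun t => ?_)
          simp only [hΦ₃, hsm]
          by_cases hGt : G t = 0
          · simp [hGt]
          · refine mul_le_mul_of_nonneg_left (hδT ?_ kl hkl).le (norm_nonneg _)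
            have : ‖t‖ ≤ ρ := not_lt.1 fun h => hGt (hGz t h)
            rw [dist_zero_right]
            linarith
      _ = η / 2 := by rw [integral_mul_const, hG1', one_mul]
  /- Step 5: Riemann sums (outer in `t₁`, then inner in `t₂`) and their coefficient masses. -/
  set w : ℕ → ℝ := fun N => (M - -M) / (2 ^ N : ℕ) with hw
  set pt : ℕ → ℕ → ℝ := fun N i => -M + i * w N with hpt
  have hw0 : ∀ N, 0 ≤ w N := fun N => div_nonneg (by linarith) (by positivity)
  have hR1 : Tendsto (fun N => ∑ i ∈ range (2 ^ N), w N • Φ₁ (pt N i)) atTop (𝓝 Ψ) :=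
    SchwartzMap.tendsto_riemannSum_of_forall_apply_eq_integral hΦ₁c hMM hΨ₁
  have hR2 : ∀ N, Tendsto (fun n => ∑ i ∈ range (2 ^ N), w N •
      ∑ j ∈ range (2 ^ n), w n • Φ₂ (pt N i, pt n j)) atTop
      (𝓝 (∑ i ∈ range (2 ^ N), w N • Φ₁ (pt N i))) := fun N =>
    tendsto_finsetSum _ fun i _ =>
      (SchwartzMap.tendsto_riemannSum_of_forall_apply_eq_integral (Φ := fun t₂ => Φ₂ (pt N i, t₂))
        (hΦ₂c.comp (by fun_prop)) hMM (hΦ₁ (pt N i))).const_smul (w N)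
  have hm1 : Tendsto (fun N => ∑ i ∈ range (2 ^ N), w N * ∫ t₂ in -M..M, ‖a (pt N i, t₂)‖) atTop
      (𝓝 (∫ p, ‖a p‖)) := by
    have hc : Continuous fun t₁ : ℝ => ∫ t₂ in -M..M, ‖a (t₁, t₂)‖ :=
      intervalIntegral.continuous_parametric_intervalIntegral_of_continuous'
        (f := fun t₁ t₂ => ‖a (t₁, t₂)‖) a.continuous.norm _ _
    have h := Literature.Analysis.Distribution.tendsto_riemannSum_intervalIntegral hc hMM
    rwa [← integral_eq_intervalIntegral_sq a.continuous.norm hM0 (fun t ht => by simp [ha0 t ht])]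
      at h
  have hm2 : ∀ N, Tendsto (fun n => ∑ i ∈ range (2 ^ N), w N *
      ∑ j ∈ range (2 ^ n), w n * ‖a (pt N i, pt n j)‖) atTop
      (𝓝 (∑ i ∈ range (2 ^ N), w N * ∫ t₂ in -M..M, ‖a (pt N i, t₂)‖)) := fun N =>
    tendsto_finsetSum _ fun i _ =>
      (Literature.Analysis.Distribution.tendsto_riemannSum_intervalIntegral
        (g := fun t₂ => ‖a (pt N i, t₂)‖) (a.continuous.norm.comp (by fun_prop)) hMM).const_mul
        (w N)
  have hsn : ∀ {u : ℕ → 𝓢(ℝ × ℝ, ℂ)} {v : 𝓢(ℝ × ℝ, ℂ)}, Tendsto u atTop (𝓝 v) →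
      ∀ᶠ m in atTop, ∀ kl ∈ s, SchwartzMap.seminorm ℝ kl.1 kl.2 (v - u m) < η / 4 := by
    intro u v hu
    refine s.eventually_all.2 fun kl _ => ?_
    have h := ((schwartz_withSeminorms ℝ (ℝ × ℝ) ℂ).tendsto_nhds u v).1 hu kl (η / 4)
      (by positivity)
    exact h.mono fun m hm => by rwa [map_sub_rev] at hm
  obtain ⟨N, hN1, hN2⟩ := ((hsn hR1).and (hm1.eventually_lt_const
    (by linarith : ∫ p, ‖a p‖ < (∫ p, ‖a p‖) + 1 / 2))).exists
  obtain ⟨n, hn1, hn2⟩ := ((hsn (hR2 N)).and ((hm2 N).eventually_lt_const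
    (lt_add_of_pos_right _ (by norm_num : (0 : ℝ) < 1 / 2)))).exists
  /- Step 6: the finite family — grid points with `a ≠ 0`, enumerated by `Fin I`. -/
  set Q : Finset (ℕ × ℕ) :=
    (range (2 ^ N) ×ˢ range (2 ^ n)).filter fun q => a (pt N q.1, pt n q.2) ≠ 0 with hQ
  set yq : ℕ × ℕ → ℝ × ℝ := fun q => (pt N q.1, pt n q.2) with hyq
  set κq : ℕ × ℕ → ℂ := fun q => ((w N * w n : ℝ) : ℂ) * a (yq q) with hκq
  have hκ0 : ∀ q, a (pt N q.1, pt n q.2) = 0 → κq q = 0 := fun q hq => by simp [hκq, hyq, hq]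
  set e := Q.equivFin with he
  refine ⟨Q.card, fun i => yq (e.symm i), fun i => κq (e.symm i), fun i => S (yq (e.symm i)),
    fun i p => by simp [hS, hyq, hG], fun i => ?_, ?_, fun kl hkl => ?_⟩
  · exact subset_tsupport _ (Function.mem_support.2 (mem_filter.1 (e.symm i).2).2)
  · have hre : ∑ i : Fin Q.card, ‖κq (e.symm i)‖ =
        ∑ q ∈ range (2 ^ N) ×ˢ range (2 ^ n), ‖κq q‖ := by
      rw [Fintype.sum_equiv e.symm _ (fun q : Q => ‖κq q‖) (fun _ => rfl),
        sum_coe_sort Q (fun q => ‖κq q‖), hQ, sum_filter_of_ne]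
      intro q _ hq
      contrapose! hq
      rw [hκ0 q hq, norm_zero]
    have hexp : ∑ q ∈ range (2 ^ N) ×ˢ range (2 ^ n), ‖κq q‖ =
        ∑ i ∈ range (2 ^ N), w N * ∑ j ∈ range (2 ^ n), w n * ‖a (pt N i, pt n j)‖ := by
      rw [sum_product]
      refine sum_congr rfl fun i _ => ?_
      rw [mul_sum]
      refine sum_congr rfl fun j _ => ?_
      simp only [hκq, hyq, norm_mul, Complex.norm_real, Real.norm_eq_abs, mul_assoc]
      rw [abs_of_nonneg (hw0 N), abs_of_nonneg (hw0 n)]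
    rw [hre, hexp]
    linarith
  · have hre : ∑ i : Fin Q.card, κq (e.symm i) • S (yq (e.symm i)) =
        ∑ i ∈ range (2 ^ N), w N • ∑ j ∈ range (2 ^ n), w n • Φ₂ (pt N i, pt n j) := by
      rw [Fintype.sum_equiv e.symm _ (fun q : Q => κq q • S (yq q)) (fun _ => rfl),
        sum_coe_sort Q (fun q => κq q • S (yq q)), hQ, sum_filter_of_ne, sum_product]
      · refine sum_congr rfl fun i _ => ?_
        rw [smul_sum]
        refine sum_congr rfl fun j _ => ?_
        simp only [hκq, hyq, hΦ₂]
        rw [mul_smul, Complex.coe_smul, mul_smul]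
      · intro q _ hq
        contrapose! hq
        rw [hκ0 q hq, zero_smul]
    rw [hre]
    have hsplit : a - ∑ i ∈ range (2 ^ N), w N • ∑ j ∈ range (2 ^ n), w n • Φ₂ (pt N i, pt n j) =
        (a - Ψ) + ((Ψ - ∑ i ∈ range (2 ^ N), w N • Φ₁ (pt N i)) +
          (∑ i ∈ range (2 ^ N), w N • Φ₁ (pt N i) -
            ∑ i ∈ range (2 ^ N), w N • ∑ j ∈ range (2 ^ n), w n • Φ₂ (pt N i, pt n j))) := by
      abel
    rw [hsplit]
    refine (map_add_le_add _ _ _).trans_lt ?_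
    have h3 := map_add_le_add (SchwartzMap.seminorm ℝ kl.1 kl.2)
      (Ψ - ∑ i ∈ range (2 ^ N), w N • Φ₁ (pt N i))
      (∑ i ∈ range (2 ^ N), w N • Φ₁ (pt N i) -
        ∑ i ∈ range (2 ^ N), w N • ∑ j ∈ range (2 ^ n), w n • Φ₂ (pt N i, pt n j))
    linarith [hmoll kl hkl, hN1 kl hkl, hn1 kl hkl]

end Summit.QuantumFields.YangMills.Theorems.SoftKernelBoostCovariance.Sketch
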